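import Literature.MathematicalPhysics.QuantumFieldTheory.Balaban1983to89.B7Eq167General
import Literature.MathematicalPhysics.QuantumFieldTheory.Balaban1983to89.B7LocalityGeneral

/-!
# `Balaban1983to89.B8Ineq172Concrete` — T. Bałaban, *Spaces of regular gauge field configurations on a lattice and gauge
# fixing conditions*, Commun. Math. Phys. **99** (1985) 75–102 [Balaban1985RegularSpaces] ("B8"), proof of Theorem 4,
# **(1.70)–(1.74) pp. 88–89**: the regularity of the inductive gauge transformation `u₁` — ON THE CONCRETE `ℤᵈ` CARRIERS,
# AT A GENERAL BACKGROUND, WITH PRINT'S LOCAL (block-tower) HYPOTHESES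

statement-level skeleton of published theorems with citation tags; proofs where landed; nothing here is a claim about the
Yang–Mills mass gap

PDF held: `paper:balaban1985-cmp99-regular-spaces-gauge-fixing` (journal page = PDF page + 74); p. 88 [PDF 14] READ AS AN
IMAGE (x2 render `…/b2b-balaban-ref1/pages/1985-cmp99-regular-spaces-gauge-fixing/…-p014-x2.png`), p. 89 [PDF 15] on the
text layer (this seat, 2026-08-25); [3] = [Balaban1985Averaging] (106)–(108) p. 33, (166)–(167) p. 44 as quoted and proved in
`B7Eq106Concrete` / `B7Eq167Flat` / `B7Eq167General`.

WHAT IS PRINTED (verbatim, p. 88–89).  "Let us consider the gauge transformation `u₁`. From (64)–(87) of [3] it follows that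
`u₁` is determined uniquely in terms of `U₁` and is given by (106). From (105) and (106) we have for `x ∈ Bʲ(Λ_j)`,
`|u₁(x) − 1| ≦ Σ_{n=j−1}^{0} (|(\overline{R̄ⁿ_{0,x_{n+1}}U̿ⁿ₁}) − 1| + |(R̄ⁿ_{0,x_{n+1}}U̿ⁿ₁)(Γ_{x_{n+1},x_n}) − 1|)
≦ 2 Σ_{n=0}^{j−1} max_{x∈B(x_{n+1})} |(1/i) log(R̄ⁿ_{0,x_{n+1}}U̿ⁿ₁)(Γ_{x_{n+1},x})|. (1.70)  Using (130) and (1.69) we obtain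
`|(1/i) log(R̄ⁿ_{0,x_{n+1}}U̿ⁿ₁)(Γ_{x_{n+1},x})| ≦ … ≦ 4dB₁(α₀ + α₁)L^{n+1−j}` (1.71) for `α₀ + α₁` sufficiently small, hence
`|u₁(x) − 1| < 8dB₁(α₀ + α₁)·1/(1 − L⁻¹) ≦ 16dB₁(α₀ + α₁)`, `x ∈ Ω₀`. (1.72)  The same argument can be applied to the averages
`\overline{R₀u₁ⁿ}`, and we get `|(\overline{R₀u₁ⁿ})(x_n) − 1| < 16dB₁(α₀ + α₁)`, `x_n ∈ Ω_n^{(n)}`. (1.73)  From (108) and (1.71) we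
obtain also `|(\overline{R₀u₁ⁿ})⁻¹(x_{n+1})(R̄ⁿ_{0,x_{n+1}}\overline{R₀u₁ⁿ})(x_n) − 1| < 4dB₁(α₀ + α₁)L^{n+1−j}` (1.74) for
`x_n ∈ B(x_{n+1})`, `x_{n+1} ∈ B^{j−n−1}(Λ_j)`, `n = 0, …, j − 1`, `j = 1, …, k − 1`".  Its inputs (1.69) "`|A| < B₁(α₀ + α₁)(Lʲη)⁻¹ …
on Ω_j`" (`U₁ = e^{iηA}`) and (1.33) = (1.7) p. 77 "`|U(∂p) − 1| < α₀L^{−2j}` for `p ∈ Ω_j`" are LOCAL (region-wise) hypotheses,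
and the constants of (1.72)–(1.73) do not depend on `j`.

WHAT THE TREE HAD / WHY THIS FILE.  `B7Eq167General` proves this chain — (166)/(167) of [3] for the gauge fixing (104)–(106)
at a general regular background, `|u(x) − 1| ≤ 40d·Lᵏb` — from GLOBAL hypotheses on all of `ℤᵈ` ((52) and `|B| ≤ b`
everywhere); `B8Ineq170` carries (1.70)–(1.74) schematically (abstract level factors).  B8 p. 88 uses the LOCAL form: for
`x ∈ Bʲ(Λ_j)` only the data of the `j`-block tower above `x` enter, with the `Ω_j`-constants.  This file supplies that
localisation on the concrete carriers by the tree's device (`B7Prop1Local.prop2_local`, `B8Ineq130.ineq130_local`,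
`B8Ineq165Local`): clamped extension of the background, zero extension of the field, the global theorem, transfer by locality.

WHAT THIS FILE PROVES (kernel, 0 sorry, theorems only, no `def`).  Tower notation: `[tlo L y n, thi L y n]` (`B8Ineq130`, with
`lo = hi = y`) = the block `Bⁿ(y)` of the level-`j` site `y` read on the lattice of level `j − n`; depth `j` is the fine block.
* §1 LOCALITY OF THE GAUGE FIXING OF [3] (algebra, any background): pairs `(U₀, U₁)`, `(U₀′, U₁′)` agreeing on the bonds of
  the fine block `Bʲ(y)` have, on the tower under `y`, the same averaged backgrounds `Ū₀ᵐ`, relative averages `Ũ₁ᵐ` (65)/(69),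
  block frames `wrec` (85), GAUGE FIXING `glev … j` (87)+(76) at every level, averages `\overline{R₀u}ᵐ` (79)/(80) and (167)-expressions
  (`avgIter_agree_tower`, `tildIter_agree_tower`, `wrec_congr_tower`, `glev_congr_tower`, `uavg_congr_tower`, `expr167_congr_tower`).
* §2 (1.72)/(1.73)/(1.74) WITH LOCAL HYPOTHESES — `U₀` `G`-valued (`G ⊂ U1` averaging-closed; print `U(N)`), regular on the
  fine block `Bʲ(y)` ONLY (`pdevOn … U₀ < α₀L^{−2j}`), `U₁ = e^{B}` with `|B_b| ≤ b` on the bonds of `Bʲ(y)` ONLY, smallness of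
  `B7Eq167General` at `k = j` (conditions on `α₀` and `Lʲb`): `norm_glev_sub_one_le_local` (`|u(x) − 1| ≤ 40d·Lʲb` on `Bʲ(y)`,
  (1.72)), `cond166_local` ((1.73), `≤ e^{20dLʲb} − 1 ≤ 40d·Lʲb` on every level of the tower), `cond167_local` ((1.74),
  `≤ e^{θ_m} − 1 ≤ 4dL^{m+1}b`), for `u = glev L _ U₀ e^{B} j 0` = THE gauge transformation (104)–(106) of [3] at top level `j`
  (unique solution of (67) + (81), `B7Eq84Concrete.gaugeFixing_unique`; B8: "`u₁` … is given by (106)").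
* §3 PRINT'S LETTERS: with (1.69) read as `|B_b| ≤ c·L^{−j}` on `Bʲ(y) ⊂ Ω_j` (`B = iηA`, `c = B₁(α₀ + α₁)`) one has `Lʲb = c`, so
  `ineq172_local` / `ineq173_local` / `ineq174_local` give `|u₁(x) − 1| ≤ 40d·c`, `|(\overline{R₀u₁}ᵐ)(x_m) − 1| ≤ 40d·c` and
  (1.74) `≤ 4d·c·L^{m+1}·L^{−j}` with every smallness condition a condition on `α₀` and `c` ALONE — print's `j`-independence.

READINGS / DECLARED DEVIATIONS (as `B7Eq167General` (M1)–(M4)): `ℤᵈ` per level; `𝔸` complete normed `ℂ`-algebra, `‖1‖ = 1`;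
`<` typed `≤`; constants explicit and merely sufficient (`40d` for print's `16d`; (1.74) with print's `4d·c·L^{m+1−j}`); (1.69)'s
gradient member unused (as in print); `u₁` = the constructed `glev` at top level `j` — the identification of B8's inductive `u₁`
with (106) on `Bʲ(Λ_j)` is [3] (64)–(87) (`B7Eq84Concrete.gauge_formula`) and is not re-derived for the multi-domain axial gauge
here; the extension device is not in print.  NOT CLAIMED: (1.75) ff.; nothing of Theorem 4 itself.  Unit `pub-ymgap-dag-n04-b`
(YM Track A, node N05 [B8]), 2026-08-25.  Tree API by name only, nothing restated.
-/

noncomputable section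

open NormedSpace Finset

namespace Literature.MathematicalPhysics.QuantumFieldTheory.Balaban1983to89.B8Ineq172Concrete

open B7Prop1Explicit B7Prop2Explicit B7Prop3Flat B7Prop1Local B7Eq92Concrete B7Eq99Concrete B7Eq84Concrete B7Eq106Concrete B7Eq167Flat
open B7Eq167General
open B7Prop5Flat (bondsIn restr mem_bondsIn insCfg_restr_of_mem agreeOn_insCfg_restr agreeOn_expCfg BondIn)
open B7LocalityGeneral (agreeOn_mul tHol_treeWord_congr)
open B8Ineq130 (fl tlo thi tlo_zero thi_zero agree_level block_mem smul_mem fl_mem inBox_of_le)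

-- `Site` alone could resolve to the torus sites of `Setup.lean`; re-export the `ℤ^d` sites of `B7Prop1Explicit`.
export B7Prop1Explicit (Site)

variable {d : ℕ}

/-! ## §1 Locality of the gauge fixing (104)–(106) of [3] on the block tower under a level-`j` site `y` -/

section Congr

variable {𝔸 : Type*} [NormedRing 𝔸] [NormedAlgebra ℂ 𝔸] [CompleteSpace 𝔸]
variable {L : ℕ} {j : ℕ} {y : Site d} {U₀ U₀' U₁ U₁' : Site d → Fin d → 𝔸ˣ}

/-- **Locality of the averaged backgrounds on the tower** ([3] p. 24: "`Ū^k_c` … depends only on the bond variables `U_b` for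
`b ⊂ B^k(c₋) ∪ B^k(c₊)`"): if `U₀`, `U₀′` agree on the bonds of the fine block `Bʲ(y)`, then `Ū₀ᵐ` and `Ū₀′ᵐ` agree on the
bonds of the block `Bⁿ(y)` of the level-`m` lattice, `n + m = j` (`B8Ineq130.agree_level` on the tower `lo = hi = y`).
[cite: Balaban1985Averaging, p.24 (sentence after (43))] -/
theorem avgIter_agree_tower (hL : 1 ≤ L) (h₀ : AgreeOn (tlo L y j) (thi L y j) U₀ U₀') {m n : ℕ} (hmn : n + m = j) :
    AgreeOn (tlo L y n) (thi L y n) (avgIter L U₀ m) (avgIter L U₀' m) :=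
  agree_level hL m n (by rw [hmn]; exact h₀)

/-- **Locality of the relative averages `Ũ₁ᵐ = (\overline{U₁U₀})ᵐ(Ū₀ᵐ)⁻¹`** ((65)/(69) of [3]) on the tower: agreement of
`(U₀, U₁)` and `(U₀′, U₁′)` on the fine block `Bʲ(y)` gives agreement of `Ũ₁ᵐ`, `Ũ₁′ᵐ` on the level-`m` block under `y`.
[cite: Balaban1985Averaging, (65) p.29, (69) p.29, p.24] -/
theorem tildIter_agree_tower (hL : 1 ≤ L) (h₀ : AgreeOn (tlo L y j) (thi L y j) U₀ U₀')
    (h₁ : AgreeOn (tlo L y j) (thi L y j) U₁ U₁') {m n : ℕ} (hmn : n + m = j) :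
    AgreeOn (tlo L y n) (thi L y n) (tildIter L U₀ U₁ m) (tildIter L U₀' U₁' m) := by
  intro q κ hq hqκ
  rw [tildIter_apply, tildIter_apply, avgIter_agree_tower hL (agreeOn_mul h₁ h₀) hmn q κ hq hqκ,
    avgIter_agree_tower hL h₀ hmn q κ hq hqκ]

/-- The transport of the averaged background `Ū₀ᵐ(Γ_{x_{m+1},x_m})` along a block tree contour of the tower (`x_{m+1} = z` a
level-`(m+1)` site of `B^{n}(y)`, `n + (m+1) = j`; `x_m = Lz + r`) is the same for `U₀` and `U₀′`.
[cite: Balaban1985Averaging, p.24, (58) p.27] -/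
theorem hol_block_congr (hL : 1 ≤ L) (h₀ : AgreeOn (tlo L y j) (thi L y j) U₀ U₀') {m n : ℕ} (hmn : n + (m + 1) = j)
    {z : Site d} (hz : tlo L y n ≤ z) (hz' : z ≤ thi L y n) (r : Fin d → Fin L) :
    hol (avgIter L U₀ m) ((L : ℤ) • z) (treeWord (boxVec L r))
      = hol (avgIter L U₀' m) ((L : ℤ) • z) (treeWord (boxVec L r)) := by
  obtain ⟨h1, h2⟩ := smul_mem hL hz hz'
  obtain ⟨h3, h4⟩ := block_mem hz hz' r
  exact hol_treeWord_congr (avgIter_agree_tower hL h₀ (show (n + 1) + m = j by omega)) _ _ (inBox_of_le h1 h2)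
    (inBox_of_le h3 h4)

/-- The twisted transport `(R̄ᵐ_{0,x_{m+1}}Ũ₁ᵐ)(Γ_{x_{m+1},x_m})` ((58)/(76) of [3]) along a block tree contour of the tower is the same
for `(U₀, U₁)` and `(U₀′, U₁′)`. [cite: Balaban1985Averaging, (58) p.27, (76) p.29, p.24] -/
theorem tHol_block_congr (hL : 1 ≤ L) (h₀ : AgreeOn (tlo L y j) (thi L y j) U₀ U₀')
    (h₁ : AgreeOn (tlo L y j) (thi L y j) U₁ U₁') {m n : ℕ} (hmn : n + (m + 1) = j)
    {z : Site d} (hz : tlo L y n ≤ z) (hz' : z ≤ thi L y n) (r : Fin d → Fin L) :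
    tHol (avgIter L U₀ m) (tildIter L U₀ U₁ m) ((L : ℤ) • z) (treeWord (boxVec L r))
      = tHol (avgIter L U₀' m) (tildIter L U₀' U₁' m) ((L : ℤ) • z) (treeWord (boxVec L r)) := by
  obtain ⟨h1, h2⟩ := smul_mem hL hz hz'
  obtain ⟨h3, h4⟩ := block_mem hz hz' r
  have hmn' : (n + 1) + m = j := by omega
  exact tHol_treeWord_congr (avgIter_agree_tower hL h₀ hmn') (tildIter_agree_tower hL h₀ h₁ hmn') _ _
    (inBox_of_le h1 h2) (inBox_of_le h3 h4)

/-- **Locality of the block frames (85) of [3]** `w_m(x_m) = \overline{R_{0,x_m}U₁}^{(m)}` on the tower: `wrec L U₀ U₁ m z = wrec L U₀′ U₁′ m z`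
at every level-`m` site `z` of `B^{n}(y)`, `n + m = j` (induction on `m` through (78)/(85): the site average reads the twisted
transports along the block contours and the frames one level down at the block points).
[cite: Balaban1985Averaging, (85) p.31, (78) p.30, p.24] -/
theorem wrec_congr_tower (hL : 1 ≤ L) (h₀ : AgreeOn (tlo L y j) (thi L y j) U₀ U₀')
    (h₁ : AgreeOn (tlo L y j) (thi L y j) U₁ U₁') :
    ∀ (m n : ℕ), n + m = j → ∀ z : Site d, tlo L y n ≤ z → z ≤ thi L y n →
      wrec L U₀ U₁ m z = wrec L U₀' U₁' m z
  | 0, n, _, z, _, _ => by rw [wrec_zero, wrec_zero]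
  | m + 1, n, hmn, z, hz, hz' => by
    rw [wrec_succ, wrec_succ]
    obtain ⟨h1, h2⟩ := smul_mem hL hz hz'
    refine savg_congr L ?_ fun r => ?_
    · simp only [sub_self, treeWord_zero, tHol_nil, one_mul, R0fun_self]
      exact wrec_congr_tower hL h₀ h₁ m (n + 1) (by omega) _ h1 h2
    · obtain ⟨h3, h4⟩ := block_mem hz hz' r
      simp only [add_sub_cancel_left, R0fun_apply]
      rw [tHol_block_congr hL h₀ h₁ hmn hz hz' r, hol_block_congr hL h₀ hmn hz hz' r,
        wrec_congr_tower hL h₀ h₁ m (n + 1) (by omega) _ h3 h4]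

/-- **LOCALITY OF THE GAUGE FIXING (104)–(106) OF [3]**: the level functions `glev … j m` of the gauge transformation determined by
`(U₀, U₁)` at top level `j` ((87) at level `j`, then (76) block by block downwards) coincide on the tower under `y` for two pairs
`(U₀, U₁)`, `(U₀′, U₁′)` agreeing on the bonds of the fine block `Bʲ(y)`: at every depth `n ≤ j` and every level-`(j−n)` site `x`
of `Bⁿ(y)`.  In particular (depth `j`) the gauge transformation itself is the same at every fine site of `Bʲ(y)` — B8 p. 88's
"for `x ∈ Bʲ(Λ_j)`" reading of (106). [cite: Balaban1985Averaging, (106) p.33, (76)–(77) p.29–30, (87) p.31; Balaban1985RegularSpaces, (1.70) p.88] -/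
theorem glev_congr_tower (hL : 1 ≤ L) (h₀ : AgreeOn (tlo L y j) (thi L y j) U₀ U₀')
    (h₁ : AgreeOn (tlo L y j) (thi L y j) U₁ U₁') :
    ∀ (n m : ℕ), n + m = j → ∀ x : Site d, tlo L y n ≤ x → x ≤ thi L y n →
      glev L hL U₀ U₁ j m x = glev L hL U₀' U₁' j m x
  | 0, m, hm, x, hx, hx' => by
    have hmj : m = j := by omega
    subst hmj
    rw [tlo_zero] at hx
    rw [thi_zero] at hx'
    rw [glev_top, glev_top, wrec_congr_tower hL h₀ h₁ m 0 (by omega) x (by simpa using hx) (by simpa using hx')]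
  | n + 1, m, hm, x, hx, hx' => by
    have hmj : m < j := by omega
    obtain ⟨hf, hf'⟩ := fl_mem hL hx hx'
    rw [glev_of_lt L hL U₀ U₁ hmj, glev_of_lt L hL U₀' U₁' hmj]
    have hx2 : (L : ℤ) • fl L x + boxVec L (brem L hL x) = x := fl_decomp hL x
    rw [hol_block_congr hL h₀ (show n + (m + 1) = j by omega) hf hf',
      tHol_block_congr hL h₀ h₁ (show n + (m + 1) = j by omega) hf hf',
      glev_congr_tower hL h₀ h₁ n (m + 1) (by omega) _ hf hf']

/-- **Locality of the averages `\overline{R₀u}ᵐ` (79)/(80) of [3]** on the tower: for gauge transformations `u`, `u′` equal on the fine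
sites of `Bʲ(y)` and backgrounds `U₀`, `U₀′` agreeing on its bonds, `(\overline{R₀u}ᵐ)(z) = (\overline{R₀u′}ᵐ)(z)` at every
level-`m` site `z` of `Bⁿ(y)`, `n + m = j` (induction on `m` through (78)). [cite: Balaban1985Averaging, (78)–(80) p.30, p.24] -/
theorem uavg_congr_tower (hL : 1 ≤ L) (h₀ : AgreeOn (tlo L y j) (thi L y j) U₀ U₀') {u u' : Site d → 𝔸ˣ}
    (hu : ∀ x : Site d, tlo L y j ≤ x → x ≤ thi L y j → u x = u' x) :
    ∀ (m n : ℕ), n + m = j → ∀ z : Site d, tlo L y n ≤ z → z ≤ thi L y n →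
      uavg L U₀ u m z = uavg L U₀' u' m z
  | 0, n, hn, z, hz, hz' => by
    have hnj : n = j := by omega
    subst hnj
    rw [uavg_zero, uavg_zero, hu z hz hz']
  | m + 1, n, hmn, z, hz, hz' => by
    rw [uavg_succ, uavg_succ, R0avg, R0avg]
    obtain ⟨h1, h2⟩ := smul_mem hL hz hz'
    refine savg_congr L ?_ fun r => ?_
    · rw [R0fun_self, R0fun_self]
      exact uavg_congr_tower hL h₀ hu m (n + 1) (by omega) _ h1 h2
    · obtain ⟨h3, h4⟩ := block_mem hz hz' r
      simp only [R0fun_apply, add_sub_cancel_left]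
      rw [hol_block_congr hL h₀ hmn hz hz' r, uavg_congr_tower hL h₀ hu m (n + 1) (by omega) _ h3 h4]

/-- **Locality of the expression of (167) of [3]** `(\overline{R₀u}ᵐ)⁻¹(x_{m+1})(R̄ᵐ_{0,x_{m+1}}\overline{R₀u}ᵐ)(x_m)` (= the left side of
B8 (1.74)) on the tower: it is the same for `(U₀, u)` and `(U₀′, u′)` as above, at every level-`(m+1)` site `z` of `Bⁿ(y)`,
`n + (m+1) = j`, and every block point `x_m = Lz + r`. [cite: Balaban1985Averaging, (167) p.44; Balaban1985RegularSpaces, (1.74) p.89] -/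
theorem expr167_congr_tower (hL : 1 ≤ L) (h₀ : AgreeOn (tlo L y j) (thi L y j) U₀ U₀') {u u' : Site d → 𝔸ˣ}
    (hu : ∀ x : Site d, tlo L y j ≤ x → x ≤ thi L y j → u x = u' x) {m n : ℕ} (hmn : n + (m + 1) = j)
    {z : Site d} (hz : tlo L y n ≤ z) (hz' : z ≤ thi L y n) (r : Fin d → Fin L) :
    (uavg L U₀ u m ((L : ℤ) • z))⁻¹
        * Rc (hol (avgIter L U₀ m) ((L : ℤ) • z) (treeWord (boxVec L r))) (uavg L U₀ u m ((L : ℤ) • z + boxVec L r))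
      = (uavg L U₀' u' m ((L : ℤ) • z))⁻¹
        * Rc (hol (avgIter L U₀' m) ((L : ℤ) • z) (treeWord (boxVec L r)))
            (uavg L U₀' u' m ((L : ℤ) • z + boxVec L r)) := by
  obtain ⟨h1, h2⟩ := smul_mem hL hz hz'
  obtain ⟨h3, h4⟩ := block_mem hz hz' r
  rw [hol_block_congr hL h₀ hmn hz hz' r, uavg_congr_tower hL h₀ hu m (n + 1) (by omega) _ h1 h2,
    uavg_congr_tower hL h₀ hu m (n + 1) (by omega) _ h3 h4]

end Congr

/-! ## §2 (1.72)/(1.73)/(1.74) with print's LOCAL hypotheses: regularity and smallness on the block `Bʲ(y)` only -/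

section Local

variable {𝔸 : Type*} [NormedRing 𝔸] [NormedAlgebra ℂ 𝔸] [CompleteSpace 𝔸] [NormOneClass 𝔸]

omit [NormedAlgebra ℂ 𝔸] [CompleteSpace 𝔸] [NormOneClass 𝔸] in
/-- The zero extension of the field given on the bonds of a box (`B7Prop3Flat.insCfg` of the restriction; the device of this file, not in
print) inherits the local bound `|B_b| ≤ b` globally. [folklore] -/
private theorem norm_insCfg_restr_le {lo hi : Site d} {B : Site d → Fin d → 𝔸} {b : ℝ} (hb : 0 ≤ b)
    (hB : ∀ (x : Site d) (κ : Fin d), InBox lo hi x → InBox lo hi (x + e κ) → ‖B x κ‖ ≤ b) (x : Site d) (κ : Fin d) :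
    ‖insCfg (bondsIn lo hi) (restr (bondsIn lo hi) B) x κ‖ ≤ b := by
  by_cases h : (x, κ) ∈ bondsIn lo hi
  · rw [insCfg_restr_of_mem _ _ h]
    obtain ⟨hx, hx'⟩ := mem_bondsIn.mp h
    exact hB x κ hx hx'
  · simp only [insCfg, h, dite_false, norm_zero]
    exact hb

variable {L : ℕ} {G : Subgroup 𝔸ˣ} {j : ℕ} {y : Site d} {U₀ : Site d → Fin d → 𝔸ˣ} {α₀ : ℝ} {B : Site d → Fin d → 𝔸} {b : ℝ}

/-- THE LOCALISATION DEVICE (the tree's, not print's; cf. `B7Prop1Local.prop2_local`, `B8Ineq130.ineq130_local`): the clamped extension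
`π*U₀` of `U₀|_{Bʲ(y)}` is `G`-valued with GLOBAL plaquette deviation at most that of `U₀` INSIDE `Bʲ(y)`, the zero extension of `B|_{Bʲ(y)}`
obeys `|·| ≤ b` everywhere, and both agree with the originals on the bonds of `Bʲ(y)` (so §1 transfers every tower quantity). [folklore] -/
private theorem local_data (hL1 : 1 ≤ L) (hG : AvgClosed d L G) (hU₀ : ∀ x κ, U₀ x κ ∈ G) {a : ℝ}
    (h52 : pdevOn (tlo L y j) (thi L y j) U₀ < a) (hb : 0 ≤ b)
    (hB : ∀ (x : Site d) (κ : Fin d), InBox (tlo L y j) (thi L y j) x → InBox (tlo L y j) (thi L y j) (x + e κ) → ‖B x κ‖ ≤ b) :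
    (∀ x κ, clampCfg (tlo L y j) (thi L y j) U₀ x κ ∈ G) ∧ pdev (clampCfg (tlo L y j) (thi L y j) U₀) < a ∧
      (∀ x κ, ‖insCfg (bondsIn (tlo L y j) (thi L y j)) (restr (bondsIn (tlo L y j) (thi L y j)) B) x κ‖ ≤ b) ∧
      AgreeOn (tlo L y j) (thi L y j) U₀ (clampCfg (tlo L y j) (thi L y j) U₀) ∧
      AgreeOn (tlo L y j) (thi L y j) (expCfg B)
        (expCfg (insCfg (bondsIn (tlo L y j) (thi L y j)) (restr (bondsIn (tlo L y j) (thi L y j)) B))) :=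
  have hlohi : ∀ i, tlo L y j i ≤ thi L y j i := B8Ineq130.tlo_le_thi hL1 le_rfl j
  have hUU : ∀ x κ, U₀ x κ ∈ U1 𝔸 := fun x κ => hG.le_U1 (hU₀ x κ)
  ⟨clampCfg_mem hU₀, (pdev_clampCfg_le hlohi hUU).trans_lt h52, norm_insCfg_restr_le hb hB, (clampCfg_agree U₀).symm,
    agreeOn_expCfg (agreeOn_insCfg_restr _ _ B)⟩

/-- **(1.72) ON THE CONCRETE CARRIERS, LOCAL HYPOTHESES** (p. 88: for `x ∈ Bʲ(Λ_j)`, `|u₁(x) − 1| < 16dB₁(α₀ + α₁)`): for a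
`G`-valued background `U₀` (`G ⊂ U1` averaging-closed; print `G ⊂ U(N)`) which is regular ON THE FINE BLOCK `Bʲ(y)` ONLY —
`sup_{p ⊂ Bʲ(y)} |U₀(∂p) − 1| < α₀L^{−2j}`, (1.7)/(1.33) at level `j` — and a field `U₁ = e^{B}` with `|B_b| ≤ b` on the bonds of `Bʲ(y)`
ONLY ((1.69) with `b = ηB₁(α₀+α₁)(Lʲη)⁻¹`), under the smallness of `B7Eq167General` at `k = j` (conditions on `α₀` and `Lʲb`): the
gauge transformation `u = glev … j 0` of (104)–(106) of [3] at top level `j` satisfies `|u(x) − 1| ≤ 40d·(Lʲb)` at every fine site `x`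
of `Bʲ(y)`.  Proof: the clamped extension of `U₀|_{Bʲ(y)}` (`B7Prop1Local.clampCfg`) and the zero extension of `B|_{Bʲ(y)}` satisfy the
global hypotheses of `B7Eq167General.norm_glev_sub_one_le`, and their gauge fixing agrees with `u` on `Bʲ(y)` (`glev_congr_tower`).
[cite: Balaban1985RegularSpaces, (1.70)–(1.72) p.88; Balaban1985Averaging, (106) p.33, (166) p.44] -/
theorem norm_glev_sub_one_le_local (hL : 2 ≤ L) (hG : AvgClosed d L G) (hU₀ : ∀ x κ, U₀ x κ ∈ G) (hα : 0 < α₀) (hα3 : C0 d * α₀ ≤ 1 / 3) (hα4 : 4 * α₀ ≤ c2' d L)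
    (h52 : pdevOn (tlo L y j) (thi L y j) U₀ < α₀ * (((L : ℝ) ^ j)⁻¹) ^ 2) (hb : 0 ≤ b)
    (hB : ∀ (x : Site d) (κ : Fin d), InBox (tlo L y j) (thi L y j) x → InBox (tlo L y j) (thi L y j) (x + e κ) → ‖B x κ‖ ≤ b)
    (hsmall : Real.exp (4 * (800 * ((d : ℝ) + 1) ^ 2 * ((d : ℝ) + 4)) * α₀)
      * (1 + 8 * (131072 * ((d : ℝ) + 1) ^ 2) * ((L : ℝ) ^ j * b)) ≤ 2)
    (hc₃ : 2 * ((L : ℝ) ^ j * b) ≤ c3 d L) (hs : 128 * (d : ℝ) * ((L : ℝ) ^ j * b) ≤ 1) (hL1 : 1 ≤ L)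
    (x : Site d) (hx : tlo L y j ≤ x) (hx' : x ≤ thi L y j) :
    ‖((glev L hL1 U₀ (expCfg B) j 0 x : 𝔸ˣ) : 𝔸) - 1‖ ≤ 40 * d * ((L : ℝ) ^ j * b) := by
  obtain ⟨hU₀c, h52c, hBc, h₀, h₁⟩ := local_data hL1 hG hU₀ h52 hb hB
  rw [glev_congr_tower hL1 h₀ h₁ j 0 (by omega) x hx hx']
  exact norm_glev_sub_one_le hL hG hU₀c hα hα3 hα4 h52c hb hBc hsmall hc₃ hs hL1 x

/-- **(1.73) ON THE CONCRETE CARRIERS, LOCAL HYPOTHESES** (p. 88: "The same argument can be applied to the averages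
`\overline{R₀u₁ⁿ}`, and we get `|(\overline{R₀u₁ⁿ})(x_n) − 1| < 16dB₁(α₀ + α₁)`, `x_n ∈ Ω_n^{(n)}`. (1.73)"): in the setting of
`norm_glev_sub_one_le_local`, at every level-`m` site `z` of the block `B^{n}(y)` of the level-`m` lattice (`n + m = j`),
`|(\overline{R₀u}ᵐ)(z) − 1| ≤ e^{20d·Lʲb} − 1 ≤ 40d·(Lʲb)` — (166) of [3] for the gauge fixing, localised.
[cite: Balaban1985RegularSpaces, (1.73) p.88; Balaban1985Averaging, (166) p.44, (107) p.33] -/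
theorem cond166_local (hL : 2 ≤ L) (hG : AvgClosed d L G) (hU₀ : ∀ x κ, U₀ x κ ∈ G) (hα : 0 < α₀) (hα3 : C0 d * α₀ ≤ 1 / 3) (hα4 : 4 * α₀ ≤ c2' d L)
    (h52 : pdevOn (tlo L y j) (thi L y j) U₀ < α₀ * (((L : ℝ) ^ j)⁻¹) ^ 2) (hb : 0 ≤ b)
    (hB : ∀ (x : Site d) (κ : Fin d), InBox (tlo L y j) (thi L y j) x → InBox (tlo L y j) (thi L y j) (x + e κ) → ‖B x κ‖ ≤ b)
    (hsmall : Real.exp (4 * (800 * ((d : ℝ) + 1) ^ 2 * ((d : ℝ) + 4)) * α₀)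
      * (1 + 8 * (131072 * ((d : ℝ) + 1) ^ 2) * ((L : ℝ) ^ j * b)) ≤ 2)
    (hc₃ : 2 * ((L : ℝ) ^ j * b) ≤ c3 d L) (hs : 128 * (d : ℝ) * ((L : ℝ) ^ j * b) ≤ 1) (hL1 : 1 ≤ L)
    {m n : ℕ} (hmn : n + m = j) (z : Site d) (hz : tlo L y n ≤ z) (hz' : z ≤ thi L y n) :
    ‖((uavg L U₀ (glev L hL1 U₀ (expCfg B) j 0) m z : 𝔸ˣ) : 𝔸) - 1‖ ≤ Real.exp (20 * d * ((L : ℝ) ^ j * b)) - 1 ∧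
      Real.exp (20 * d * ((L : ℝ) ^ j * b)) - 1 ≤ 40 * d * ((L : ℝ) ^ j * b) := by
  obtain ⟨hU₀c, h52c, hBc, h₀, h₁⟩ := local_data hL1 hG hU₀ h52 hb hB
  have hu := glev_congr_tower hL1 h₀ h₁ j 0 (by omega)
  refine ⟨?_, ?_⟩
  · rw [uavg_congr_tower hL1 h₀ hu m n hmn z hz hz']
    exact cond166_general hL hG hU₀c hα hα3 hα4 h52c hb hBc hsmall hc₃ hs (axialGauge_glev L hL1 _ _ j)
      (eq81_glev L hL1 _ _ j) m (by omega) z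
  · have h0 : (0 : ℝ) ≤ (d : ℝ) * ((L : ℝ) ^ j * b) := by positivity
    have := exp_sub_one_le_two_mul_of_le (x := 20 * (d : ℝ) * ((L : ℝ) ^ j * b)) (by positivity) le_rfl (by linarith)
    linarith

/-- **(1.74) ON THE CONCRETE CARRIERS, LOCAL HYPOTHESES** (p. 89: "From (108) and (1.71) we obtain also
`|(\overline{R₀u₁ⁿ})⁻¹(x_{n+1})(R̄ⁿ_{0,x_{n+1}}\overline{R₀u₁ⁿ})(x_n) − 1| < 4dB₁(α₀ + α₁)L^{n+1−j}` (1.74) for `x_n ∈ B(x_{n+1})`,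
`x_{n+1} ∈ B^{j−n−1}(Λ_j)`"): in the setting of `norm_glev_sub_one_le_local`, for every level-`(m+1)` site `z` of the block `B^{n}(y)`
(`n + (m+1) = j`) and every block point `x_m = Lz + r`, the expression of (1.74) = (167) of [3] is `≤ e^{θ_m} − 1 ≤ 2θ_m = 4d·L^{m+1}b`
(`θ_m = 2dL^{m+1}b`, `B7Eq167Flat.theta`) — by (108) of [3] it IS the twisted transport of `U̿₁ᵐ` along `Γ_{x_{m+1},x_m}`, localised.
[cite: Balaban1985RegularSpaces, (1.74) p.89, (1.71) p.88; Balaban1985Averaging, (167) p.44, (108) p.33] -/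
theorem cond167_local (hL : 2 ≤ L) (hG : AvgClosed d L G) (hU₀ : ∀ x κ, U₀ x κ ∈ G) (hα : 0 < α₀) (hα3 : C0 d * α₀ ≤ 1 / 3) (hα4 : 4 * α₀ ≤ c2' d L)
    (h52 : pdevOn (tlo L y j) (thi L y j) U₀ < α₀ * (((L : ℝ) ^ j)⁻¹) ^ 2) (hb : 0 ≤ b)
    (hB : ∀ (x : Site d) (κ : Fin d), InBox (tlo L y j) (thi L y j) x → InBox (tlo L y j) (thi L y j) (x + e κ) → ‖B x κ‖ ≤ b)
    (hsmall : Real.exp (4 * (800 * ((d : ℝ) + 1) ^ 2 * ((d : ℝ) + 4)) * α₀)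
      * (1 + 8 * (131072 * ((d : ℝ) + 1) ^ 2) * ((L : ℝ) ^ j * b)) ≤ 2)
    (hc₃ : 2 * ((L : ℝ) ^ j * b) ≤ c3 d L) (hs : 128 * (d : ℝ) * ((L : ℝ) ^ j * b) ≤ 1) (hL1 : 1 ≤ L)
    {m n : ℕ} (hmn : n + (m + 1) = j) (z : Site d) (hz : tlo L y n ≤ z) (hz' : z ≤ thi L y n) (r : Fin d → Fin L) :
    ‖((((uavg L U₀ (glev L hL1 U₀ (expCfg B) j 0) m ((L : ℤ) • z))⁻¹
          * Rc (hol (avgIter L U₀ m) ((L : ℤ) • z) (treeWord (boxVec L r)))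
              (uavg L U₀ (glev L hL1 U₀ (expCfg B) j 0) m ((L : ℤ) • z + boxVec L r)) : 𝔸ˣ)) : 𝔸) - 1‖
        ≤ Real.exp (theta d L b m) - 1 ∧
      Real.exp (theta d L b m) - 1 ≤ 4 * d * b * (L : ℝ) ^ (m + 1) := by
  obtain ⟨hU₀c, h52c, hBc, h₀, h₁⟩ := local_data hL1 hG hU₀ h52 hb hB
  have hu := glev_congr_tower hL1 h₀ h₁ j 0 (by omega)
  refine ⟨?_, ?_⟩
  · rw [expr167_congr_tower hL1 h₀ hu hmn hz hz' r]
    exact cond167_general hL hG hU₀c hα hα3 hα4 h52c hb hBc hsmall hc₃ (axialGauge_glev L hL1 _ _ j) m (by omega) z r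
  · have hθ1 : theta d L b m ≤ 1 := by linarith [theta_le_of_lt d hL1 hb (show m < j by omega) hs]
    refine (exp_sub_one_le_two_mul_of_le (theta_nonneg d L hb m) le_rfl hθ1).trans (le_of_eq ?_)
    rw [theta_eq]; ring

end Local

/-! ## §3 Print's letters: (1.69) on `Ω_j ⊇ Bʲ(y)` reads `|B_b| ≤ c·L^{−j}`, `c = B₁(α₀ + α₁)`; the constants do not depend on `j` -/

section Printed

variable {𝔸 : Type*} [NormedRing 𝔸] [NormedAlgebra ℂ 𝔸] [CompleteSpace 𝔸] [NormOneClass 𝔸]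
variable {L : ℕ} {G : Subgroup 𝔸ˣ} {j : ℕ} {y : Site d} {U₀ : Site d → Fin d → 𝔸ˣ} {α₀ : ℝ} {B : Site d → Fin d → 𝔸} {c : ℝ}

omit [NormOneClass 𝔸] in
/-- Bookkeeping: with `b = c·L^{−j}`, `Lʲb = c`. [folklore] -/
private theorem pow_mul_mul_inv_pow (hL1 : 1 ≤ L) (j : ℕ) (c : ℝ) : (L : ℝ) ^ j * (c * ((L : ℝ) ^ j)⁻¹) = c := by
  have hLj : (0 : ℝ) < (L : ℝ) ^ j := by
    have : (1 : ℝ) ≤ L := by exact_mod_cast hL1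
    positivity
  field_simp

/-- **(1.72) IN PRINT'S LETTERS, `j`-INDEPENDENT CONSTANT** (p. 88: "`|u₁(x) − 1| < 8dB₁(α₀ + α₁)·1/(1 − L⁻¹) ≦ 16dB₁(α₀ + α₁)`,
`x ∈ Ω₀`. (1.72)"): on the block tower under a level-`j` site `y` (`Bʲ(y) ⊂ Ω_j` when `y ∈ Λ_j`), if `U₀` is `G`-valued and regular on
`Bʲ(y)` at level `j` ((1.33): `|U₀(∂p) − 1| < α₀L^{−2j}`) and `U₁ = e^{B}` obeys (1.69) there as `|B_b| ≤ c·L^{−j}` (`B = iηA`,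
`c = B₁(α₀ + α₁)`), then — for `α₀`, `c` small as displayed, NO CONDITION INVOLVING `j` — the gauge transformation `u₁` of (106) at top
level `j` satisfies `|u₁(x) − 1| ≤ 40d·c` on `Bʲ(y)` (print `16d·c`; the geometric sum `Σ_n L^{n+1−j}` is absorbed in `Lʲb = c`).
[cite: Balaban1985RegularSpaces, (1.72) p.88, (1.69) p.88, (1.33) p.82] -/
theorem ineq172_local (hL : 2 ≤ L) (hG : AvgClosed d L G) (hU₀ : ∀ x κ, U₀ x κ ∈ G) (hα : 0 < α₀) (hα3 : C0 d * α₀ ≤ 1 / 3) (hα4 : 4 * α₀ ≤ c2' d L)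
    (h33 : pdevOn (tlo L y j) (thi L y j) U₀ < α₀ * (((L : ℝ) ^ j)⁻¹) ^ 2) (hc : 0 ≤ c)
    (h69 : ∀ (x : Site d) (κ : Fin d), InBox (tlo L y j) (thi L y j) x → InBox (tlo L y j) (thi L y j) (x + e κ) →
      ‖B x κ‖ ≤ c * ((L : ℝ) ^ j)⁻¹)
    (hsmall : Real.exp (4 * (800 * ((d : ℝ) + 1) ^ 2 * ((d : ℝ) + 4)) * α₀) * (1 + 8 * (131072 * ((d : ℝ) + 1) ^ 2) * c) ≤ 2)
    (hc₃ : 2 * c ≤ c3 d L) (hs : 128 * (d : ℝ) * c ≤ 1) (hL1 : 1 ≤ L)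
    (x : Site d) (hx : tlo L y j ≤ x) (hx' : x ≤ thi L y j) :
    ‖((glev L hL1 U₀ (expCfg B) j 0 x : 𝔸ˣ) : 𝔸) - 1‖ ≤ 40 * d * c := by
  have hkey := pow_mul_mul_inv_pow hL1 j c
  have hb : 0 ≤ c * ((L : ℝ) ^ j)⁻¹ := by positivity
  have h := norm_glev_sub_one_le_local hL hG hU₀ hα hα3 hα4 h33 hb h69 (by rw [hkey]; exact hsmall) (by rw [hkey]; exact hc₃)
    (by rw [hkey]; exact hs) hL1 x hx hx'
  rwa [hkey] at h

/-- **(1.73) IN PRINT'S LETTERS, `j`-INDEPENDENT CONSTANT** (p. 88: "`|(\overline{R₀u₁ⁿ})(x_n) − 1| < 16dB₁(α₀ + α₁)`, `x_n ∈ Ω_n^{(n)}`.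
(1.73)"): in the setting of `ineq172_local`, at every level-`m` site `z` of the tower under `y` (`z ∈ B^{j−m}(y)` read on the level-`m`
lattice), `|(\overline{R₀u₁}ᵐ)(z) − 1| ≤ 40d·c`. [cite: Balaban1985RegularSpaces, (1.73) p.88; Balaban1985Averaging, (166) p.44] -/
theorem ineq173_local (hL : 2 ≤ L) (hG : AvgClosed d L G) (hU₀ : ∀ x κ, U₀ x κ ∈ G) (hα : 0 < α₀) (hα3 : C0 d * α₀ ≤ 1 / 3) (hα4 : 4 * α₀ ≤ c2' d L)
    (h33 : pdevOn (tlo L y j) (thi L y j) U₀ < α₀ * (((L : ℝ) ^ j)⁻¹) ^ 2) (hc : 0 ≤ c)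
    (h69 : ∀ (x : Site d) (κ : Fin d), InBox (tlo L y j) (thi L y j) x → InBox (tlo L y j) (thi L y j) (x + e κ) →
      ‖B x κ‖ ≤ c * ((L : ℝ) ^ j)⁻¹)
    (hsmall : Real.exp (4 * (800 * ((d : ℝ) + 1) ^ 2 * ((d : ℝ) + 4)) * α₀) * (1 + 8 * (131072 * ((d : ℝ) + 1) ^ 2) * c) ≤ 2)
    (hc₃ : 2 * c ≤ c3 d L) (hs : 128 * (d : ℝ) * c ≤ 1) (hL1 : 1 ≤ L)
    {m n : ℕ} (hmn : n + m = j) (z : Site d) (hz : tlo L y n ≤ z) (hz' : z ≤ thi L y n) :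
    ‖((uavg L U₀ (glev L hL1 U₀ (expCfg B) j 0) m z : 𝔸ˣ) : 𝔸) - 1‖ ≤ 40 * d * c := by
  have hkey := pow_mul_mul_inv_pow hL1 j c
  have hb : 0 ≤ c * ((L : ℝ) ^ j)⁻¹ := by positivity
  have h := cond166_local hL hG hU₀ hα hα3 hα4 h33 hb h69 (by rw [hkey]; exact hsmall) (by rw [hkey]; exact hc₃)
    (by rw [hkey]; exact hs) hL1 hmn z hz hz'
  rw [hkey] at h
  exact h.1.trans h.2

/-- **(1.74) IN PRINT'S LETTERS** (p. 89: "`|(\overline{R₀u₁ⁿ})⁻¹(x_{n+1})(R̄ⁿ_{0,x_{n+1}}\overline{R₀u₁ⁿ})(x_n) − 1| < 4dB₁(α₀ + α₁)L^{n+1−j}`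
(1.74) for `x_n ∈ B(x_{n+1})`, `x_{n+1} ∈ B^{j−n−1}(Λ_j)`, `n = 0, …, j − 1`"): in the setting of `ineq172_local`, for every level-`(m+1)`
site `z` of the tower under `y` (`n + (m+1) = j`) and every block point `x_m = Lz + r`, the left side of (1.74) is
`≤ 4d·c·L^{m+1}·L^{−j}` — PRINT'S BOUND with `c = B₁(α₀ + α₁)`. [cite: Balaban1985RegularSpaces, (1.74) p.89; Balaban1985Averaging, (167) p.44] -/
theorem ineq174_local (hL : 2 ≤ L) (hG : AvgClosed d L G) (hU₀ : ∀ x κ, U₀ x κ ∈ G) (hα : 0 < α₀) (hα3 : C0 d * α₀ ≤ 1 / 3) (hα4 : 4 * α₀ ≤ c2' d L)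
    (h33 : pdevOn (tlo L y j) (thi L y j) U₀ < α₀ * (((L : ℝ) ^ j)⁻¹) ^ 2) (hc : 0 ≤ c)
    (h69 : ∀ (x : Site d) (κ : Fin d), InBox (tlo L y j) (thi L y j) x → InBox (tlo L y j) (thi L y j) (x + e κ) →
      ‖B x κ‖ ≤ c * ((L : ℝ) ^ j)⁻¹)
    (hsmall : Real.exp (4 * (800 * ((d : ℝ) + 1) ^ 2 * ((d : ℝ) + 4)) * α₀) * (1 + 8 * (131072 * ((d : ℝ) + 1) ^ 2) * c) ≤ 2)
    (hc₃ : 2 * c ≤ c3 d L) (hs : 128 * (d : ℝ) * c ≤ 1) (hL1 : 1 ≤ L)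
    {m n : ℕ} (hmn : n + (m + 1) = j) (z : Site d) (hz : tlo L y n ≤ z) (hz' : z ≤ thi L y n) (r : Fin d → Fin L) :
    ‖((((uavg L U₀ (glev L hL1 U₀ (expCfg B) j 0) m ((L : ℤ) • z))⁻¹
          * Rc (hol (avgIter L U₀ m) ((L : ℤ) • z) (treeWord (boxVec L r)))
              (uavg L U₀ (glev L hL1 U₀ (expCfg B) j 0) m ((L : ℤ) • z + boxVec L r)) : 𝔸ˣ)) : 𝔸) - 1‖
      ≤ 4 * d * c * (L : ℝ) ^ (m + 1) * ((L : ℝ) ^ j)⁻¹ := by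
  have hkey := pow_mul_mul_inv_pow hL1 j c
  have hb : 0 ≤ c * ((L : ℝ) ^ j)⁻¹ := by positivity
  have h := cond167_local hL hG hU₀ hα hα3 hα4 h33 hb h69 (by rw [hkey]; exact hsmall) (by rw [hkey]; exact hc₃)
    (by rw [hkey]; exact hs) hL1 hmn z hz hz' r
  refine h.1.trans (h.2.trans (le_of_eq ?_))
  ring

end Printed

end Literature.MathematicalPhysics.QuantumFieldTheory.Balaban1983to89.B8Ineq172Concrete

end
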